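import Literature.MathematicalPhysics.QuantumLattice.GrassmannEffectiveActionTruncationDB
import HarnessLib

/-!
# The GRADED truncated single-scale step for determinant-bounded covariances: the orders `2 ≤ n < N₀` of
# `effAction C V − e^{Δ_C} V` in product form WITH the leg constraint, the rest as a geometric tail

Topic `MathematicalPhysics/QuantumLattice`; continuation of `GrassmannEffectiveActionTruncationDB`.  There the non-linear part of the
renormalisation-group map is bounded FLATLY: `Σ_{W : W_i = w} ‖kernel_m (effAction C V − e^{Δ_C}V)(W)‖ ≤ ρ^{-m} e‖V‖_h θ/(1−θ)`,
`θ = eα‖V‖_h/κ²`, `‖V‖_h = Σ_{m'} (e²(κ+ρ))^{2m'} N(m')` — of first order in `‖V‖_h` in EVERY output degree `m`, which loses the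
perturbative order of the high-degree kernels (the degree-`2p` kernel of a cumulant of order `n` of kernels of half-degrees `δ_a` is
non-zero only if `2p + 2(n−1) ≤ Σ_a 2δ_a`: each of the `n − 1` lines of a connecting tree consumes two fields; Benfatto–Giuliani–
Mastropietro 2006, (2.13)–(2.14), (2.83): the `2p`-leg kernel carries `λ^{p−1}`).  Here the orders `2 ≤ n < N₀` are kept in the PRODUCT
form of `GrassmannCumulantBoundDB.sum_norm_kernel_cumulantOf_le_of_gramBounded` with the leg constraint, and only the orders `≥ N₀` are
bounded flatly:

* `cumulantBound_le_indicator_prod` — one degree assignment `δ` under the constraint `r + 2(n−1) ≤ Σ_a 2δ_a`: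
  `cumulantBound(n, κ, α, λ_δ, N, r, δ) ≤ ρ^{-r} κ^{-2(n−1)} (n−1)! α^{n−1} eⁿ · Π_a (e²(κ+ρ))^{2δ_a} N(δ_a)` (`λ_δ = 1/(α(N_δ+n))`;
  the per-assignment majorisation inside `sum_norm_kernel_cumulantOf_le_pow_of_gramBounded`, read before the sum over ALL `δ`);
* `sum_norm_kernel_cumulantOf_le_graded_of_gramBounded` — `Σ_{W : W_i = w} ‖kernel_r 𝓔ᵀ_C(V; n)(W)‖ ≤
  n! · ρ^{-r} κ^{-2(n−1)} α^{n−1} eⁿ · Σ_{δ : r + 2(n−1) ≤ Σ 2δ_a} Π_a (e²(κ+ρ))^{2δ_a} N(δ_a)`;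
* **`sum_norm_kernel_effAction_sub_gaussConv_le_graded_of_gramBounded`** — with `θ < 1`, for every `N₀ ≥ 2` and every degree `m ≥ 1`,
  one output label pinned,
  `Σ_{W : W_i = w} ‖kernel_m (effAction C V − e^{Δ_C}V)(W)‖ ≤
     Σ_{n=2}^{N₀−1} ρ^{-m} κ^{-2(n−1)} α^{n−1} eⁿ · Σ_{δ ∈ [0,|Γ|/2]^n, m + 2(n−1) ≤ Σ 2δ_a} Π_a (e²(κ+ρ))^{2δ_a} N(δ_a) + ρ^{-m} e‖V‖_h θ^{N₀−1}/(1−θ)`.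

With `ρ = κ` the graded term of order `n` in degree `m = 2p` reads `e (eα/κ²)^{n−1} κ^{-2p} Σ_{δ: p+n−1 ≤ Σδ_a} Π_a (4e⁴κ²)^{δ_a} N(δ_a)`: inputs with
a geometric profile `N(δ) ≤ A' λ^{δ−1} Q'^δ` give `Π_a N(δ_a) ≤ A'^n λ^{p−1} λ^{(excess)} Q'^{Σδ}` — the constraint DELIVERS the order `λ^{p−1}`
(cell gate-hubbard-kl, K3 engine child stub (b): supplier G1 of the blocked-tower bookkeeping, E1-TOWER-BLOCKED §3; its dimensionless form is
the hypothesis (Hstep) of `Summit.….Theorems.EngineV8.towerStep_le_profile`).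

Everything is proved; no definition, no named fact.

## Sources

G. Benfatto, A. Giuliani, V. Mastropietro, Ann. Henri Poincaré 7 (2006) 809–898, (2.13)–(2.14), (2.77)–(2.80), (2.83), (2.86)–(2.90)
[`BenfattoGiulianiMastropietro2006`]; W. de Siqueira Pedra, M. Salmhofer, Comm. Math. Phys. 282 (2008) 797–818, Thm 2.4
[`PedraSalmhofer2008`]; K. Gawȩdzki, A. Kupiainen, Comm. Math. Phys. 102 (1985) 1–30, §3 [`GawedzkiKupiainen1985GrossNeveu`].
-/

noncomputable section

namespace Literature.MathematicalPhysics.QuantumLattice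

open GrassmannAlgebra Finset Literature.Probability.LatticeModels
open scoped InnerProductSpace Nat

universe u

variable {𝕜 : Type*} [RCLike 𝕜] {Γ : Type u} [Fintype Γ] [DecidableEq Γ] {n : ℕ} (C : Matrix Γ Γ 𝕜)

/-! ### One degree assignment, on the leg constraint -/

omit [DecidableEq Γ] in
/-- **The per-assignment majorisation of `cumulantBound` on the leg constraint** (the step inside
`sum_norm_kernel_cumulantOf_le_pow_of_gramBounded`, read before summing over all assignments): for `r + 2(n−1) ≤ Σ_a 2δ_a` and
`λ_δ = 1/(α(N_δ + n))`, `cumulantBound(n, κ, α, λ_δ, N, r, δ) ≤ ρ^{-r} κ^{-2(n−1)} (n−1)! α^{n−1} eⁿ · Π_a (e²(κ+ρ))^{2δ_a} N(δ_a)`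
(the binomial term by `choose_mul_pow_le`, the tree factor by `treeFactor_choice_le`). [cite: BenfattoGiulianiMastropietro2006, (2.77)-(2.80)] -/
theorem cumulantBound_le_indicator_prod {κ α ρ : ℝ} (hκ : 0 < κ) (hα : 0 < α) (hρ : 0 < ρ) (hn : 0 < n) (N : ℕ → ℝ)
    (hN0 : ∀ m', 0 ≤ N m') (r : ℕ) (δ : Fin n → ℕ) (hle : r + 2 * (n - 1) ≤ ∑ a, 2 * δ a) :
    cumulantBound n κ α ((α * ((∑ a, (2 * δ a : ℝ)) + n))⁻¹) N r δ ≤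
      (ρ⁻¹ ^ r * κ⁻¹ ^ (2 * (n - 1)) * (((n - 1)! : ℝ) * α ^ (n - 1) * Real.exp n)) *
        ∏ a, (Real.exp 2 * (κ + ρ)) ^ (2 * δ a) * N (δ a) := by
  rw [cumulantBound]
  have hA := choose_mul_pow_le (N := ∑ a, 2 * δ a) (r := r) (m := 2 * (n - 1)) hle hκ hρ
  have hT := treeFactor_choice_le hn δ hα
  have hNprod : 0 ≤ ∏ a, N (δ a) := prod_nonneg fun a _ => hN0 _
  have hTnonneg : 0 ≤ ((α * ((∑ a, (2 * δ a : ℝ)) + n))⁻¹)⁻¹ ^ (n - 1) *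
      ∏ ℓ : Sym2 (Fin n), (1 + (α * ((∑ a, (2 * δ a : ℝ)) + n))⁻¹ * (α * (pairDeg (fun a => 2 * δ a) ℓ : ℝ))) := by
    have hs : 0 ≤ ∑ a, (2 * δ a : ℝ) := sum_nonneg fun a _ => by positivity
    exact mul_nonneg (by positivity) (prod_nonneg fun ℓ _ => by positivity)
  calc ((((r ! : ℝ))⁻¹ * ((∑ a, 2 * δ a).descFactorial r : ℝ)) * κ ^ ((∑ a, 2 * δ a) - (r + 2 * (n - 1))) * ∏ a, N (δ a)) *
        (((α * ((∑ a, (2 * δ a : ℝ)) + n))⁻¹)⁻¹ ^ (n - 1) *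
          ∏ ℓ : Sym2 (Fin n), (1 + (α * ((∑ a, (2 * δ a : ℝ)) + n))⁻¹ * (α * (pairDeg (fun a => 2 * δ a) ℓ : ℝ))))
      ≤ ((ρ⁻¹ ^ r * κ⁻¹ ^ (2 * (n - 1)) * (κ + ρ) ^ (∑ a, 2 * δ a)) * ∏ a, N (δ a)) *
          (((n - 1)! : ℝ) * α ^ (n - 1) * Real.exp (2 * (∑ a, (2 * δ a : ℝ)) + n)) :=
        mul_le_mul (mul_le_mul_of_nonneg_right hA hNprod) hT hTnonneg (by positivity)
    _ = (ρ⁻¹ ^ r * κ⁻¹ ^ (2 * (n - 1)) * (((n - 1)! : ℝ) * α ^ (n - 1) * Real.exp n)) *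
          ∏ a, (Real.exp 2 * (κ + ρ)) ^ (2 * δ a) * N (δ a) := by
        have hexp : Real.exp (2 * (∑ a, (2 * δ a : ℝ)) + n) = Real.exp n * ∏ a, Real.exp 2 ^ (2 * δ a) := by
          rw [Real.exp_add, mul_comm, mul_sum, Real.exp_sum]
          congr 1
          refine prod_congr rfl fun a _ => ?_
          rw [← Real.exp_nat_mul]
          congr 1
          push_cast
          ring
        rw [hexp, ← prod_pow_eq_pow_sum]
        simp only [mul_pow, prod_mul_distrib]
        ring

/-! ### The graded cumulant bound -/

/-- **The graded `L¹–L^∞` bound for the kernels of `𝓔ᵀ_C(V; n)`** (`sum_norm_kernel_cumulantOf_le_of_gramBounded` with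
`λ_δ = 1/(α(N_δ+n))` and `cumulantBound_le_indicator_prod`, the leg constraint KEPT): for `V = Σ_{m' ∈ degs} Σ_Y K_{m'}(Y) ψ(Y)` with
anchored `L¹` norms `≤ N(m')`, a charged replica-Gram-bounded covariance (constant `κ > 0`), one-copy row and column sums `≤ α`, an output
weight `ρ > 0`, one output label pinned:
`Σ_{W : W_i = w} ‖kernel_r 𝓔ᵀ_C(V; n)(W)‖ ≤ n! · ρ^{-r} κ^{-2(n−1)} α^{n−1} eⁿ · Σ_{δ : r + 2(n−1) ≤ Σ_a 2δ_a} Π_a (e²(κ+ρ))^{2δ_a} N(δ_a)`.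
[cite: BenfattoGiulianiMastropietro2006, (2.13)-(2.14) and (2.77)-(2.80)] -/
theorem sum_norm_kernel_cumulantOf_le_graded_of_gramBounded {κ : ℝ} (hκ : 0 < κ) (hGB : IsGramBoundedR C κ)
    (degs : Finset ℕ) (K : (m' : ℕ) → (Fin (2 * m') → Γ) → 𝕜) (N : ℕ → ℝ) (hN0 : ∀ m', 0 ≤ N m')
    (hN : ∀ m' (j : Fin (2 * m')) (w : Γ), ∑ Y ∈ univ.filter (fun Y : Fin (2 * m') → Γ => Y j = w), ‖K m' Y‖ ≤ N m')
    {α : ℝ} (hα : 0 < α) (hrow : ∀ X, ∑ Y, ‖C X Y‖ ≤ α) (hcol : ∀ Y, ∑ X, ‖C X Y‖ ≤ α) {ρ : ℝ} (hρ : 0 < ρ)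
    (hn : 0 < n) {r : ℕ} (i : Fin r) (w : Γ) :
    ∑ W ∈ univ.filter (fun W : Fin r → Γ => W i = w),
        ‖kernel 𝕜 ((cumulantOf (fun k => evenGaussConv 𝕜 C (vertexOf 𝕜 degs K ^ k)) n : evenPart 𝕜 Γ) : GrassmannAlgebra 𝕜 Γ) r W‖ ≤
      (n ! : ℝ) * (ρ⁻¹ ^ r * κ⁻¹ ^ (2 * (n - 1)) * (α ^ (n - 1) * Real.exp n)) *
        ∑ δ ∈ (Fintype.piFinset fun _ : Fin n => degs) with r + 2 * (n - 1) ≤ ∑ a, 2 * δ a,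
          ∏ a, (Real.exp 2 * (κ + ρ)) ^ (2 * δ a) * N (δ a) := by
  have h := sum_norm_kernel_cumulantOf_le_of_gramBounded C hκ.le hGB degs K N hN0 hN hα.le hrow hcol
    (fun δ => (α * ((∑ a, (2 * δ a : ℝ)) + n))⁻¹) (fun δ => by positivity) hn i w
  refine h.trans ?_
  set c : ℝ := ρ⁻¹ ^ r * κ⁻¹ ^ (2 * (n - 1)) * (((n - 1)! : ℝ) * α ^ (n - 1) * Real.exp n) with hc
  rw [← sum_filter]
  calc (n : ℝ) * ∑ δ ∈ (Fintype.piFinset fun _ : Fin n => degs) with r + 2 * (n - 1) ≤ ∑ a, 2 * δ a,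
          cumulantBound n κ α ((α * ((∑ a, (2 * δ a : ℝ)) + n))⁻¹) N r δ
      ≤ (n : ℝ) * ∑ δ ∈ (Fintype.piFinset fun _ : Fin n => degs) with r + 2 * (n - 1) ≤ ∑ a, 2 * δ a,
          c * ∏ a, (Real.exp 2 * (κ + ρ)) ^ (2 * δ a) * N (δ a) :=
        mul_le_mul_of_nonneg_left (sum_le_sum fun δ hδ =>
          cumulantBound_le_indicator_prod hκ hα hρ hn N hN0 r δ (mem_filter.1 hδ).2) (Nat.cast_nonneg n)
    _ = (n ! : ℝ) * (ρ⁻¹ ^ r * κ⁻¹ ^ (2 * (n - 1)) * (α ^ (n - 1) * Real.exp n)) *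
          ∑ δ ∈ (Fintype.piFinset fun _ : Fin n => degs) with r + 2 * (n - 1) ≤ ∑ a, 2 * δ a,
            ∏ a, (Real.exp 2 * (κ + ρ)) ^ (2 * δ a) * N (δ a) := by
        rw [← mul_sum, hc, ← Nat.mul_factorial_pred (Nat.pos_iff_ne_zero.1 hn), Nat.cast_mul]
        ring

/-! ### The graded truncated step -/

/-- **The non-linear part of the renormalisation-group map, GRADED** (Benfatto–Giuliani–Mastropietro 2006, (2.13)–(2.14), (2.83),
(2.86)–(2.90); Gawȩdzki–Kupiainen 1985, §3): with `θ = eα‖V‖_h/κ² < 1` (`‖V‖_h = Σ_{m' ≤ |Γ|/2} (e²(κ+ρ))^{2m'} N(m')`), for every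
`N₀ ≥ 2` and every degree `m ≥ 1`, one output label pinned,
`Σ_{W : W_i = w} ‖kernel_m (effAction C V − e^{Δ_C} V)(W)‖ ≤
   Σ_{n=2}^{N₀−1} ρ^{-m} κ^{-2(n−1)} α^{n−1} eⁿ · Σ_{δ ∈ [0,|Γ|/2]^n, m + 2(n−1) ≤ Σ_a 2δ_a} Π_a (e²(κ+ρ))^{2δ_a} N(δ_a) + ρ^{-m} e‖V‖_h θ^{N₀−1}/(1−θ)`
— the cumulants of orders `2 … N₀−1` in product form with the leg constraint (what carries the perturbative order of the high-degree
kernels), the orders `≥ N₀` as the geometric tail of `sum_norm_kernel_effAction_add_sum_cumulant_le_of_gramBounded`.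
[cite: BenfattoGiulianiMastropietro2006, (2.13)-(2.14) and (2.86)-(2.90)] -/
theorem sum_norm_kernel_effAction_sub_gaussConv_le_graded_of_gramBounded {κ : ℝ} (hκ : 0 < κ) (hGB : IsGramBoundedR C κ)
    (V : GrassmannAlgebra 𝕜 Γ) (hV : V ∈ evenPart 𝕜 Γ) (hV0 : constPart 𝕜 V = 0) (N : ℕ → ℝ) (hN0 : ∀ m', 0 ≤ N m')
    (hN : ∀ m' (j : Fin (2 * m')) (w : Γ), ∑ Y ∈ univ.filter (fun Y : Fin (2 * m') → Γ => Y j = w), ‖kernel 𝕜 V (2 * m') Y‖ ≤ N m')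
    {α : ℝ} (hα : 0 < α) (hrow : ∀ X, ∑ Y, ‖C X Y‖ ≤ α) (hcol : ∀ Y, ∑ X, ‖C X Y‖ ≤ α) {ρ : ℝ} (hρ : 0 < ρ)
    (hθ : Real.exp 1 * α * normV Γ κ ρ N / κ ^ 2 < 1) {N₀ : ℕ} (hN₀ : 2 ≤ N₀) {m : ℕ} (hm : 0 < m) (i : Fin m) (w : Γ) :
    ∑ W ∈ univ.filter (fun W : Fin m → Γ => W i = w), ‖kernel 𝕜 (effAction 𝕜 C V - gaussConv 𝕜 C V) m W‖ ≤
      ∑ n ∈ Ico 2 N₀, (ρ⁻¹ ^ m * κ⁻¹ ^ (2 * (n - 1)) * (α ^ (n - 1) * Real.exp n)) *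
          ∑ δ ∈ (Fintype.piFinset fun _ : Fin n => range (Fintype.card Γ / 2 + 1)) with m + 2 * (n - 1) ≤ ∑ a, 2 * δ a,
            ∏ a, (Real.exp 2 * (κ + ρ)) ^ (2 * δ a) * N (δ a) +
        ρ⁻¹ ^ m * (Real.exp 1 * normV Γ κ ρ N) *
          (Real.exp 1 * α * normV Γ κ ρ N / κ ^ 2) ^ (N₀ - 1) / (1 - Real.exp 1 * α * normV Γ κ ρ N / κ ^ 2) := by
  -- notation (as in `sum_norm_kernel_effAction_add_sum_cumulant_le_of_gramBounded`)
  set X : evenPart 𝕜 Γ := ⟨-V, neg_mem hV⟩ with hX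
  set degs : Finset ℕ := range (Fintype.card Γ / 2 + 1) with hdegs
  set K : (m' : ℕ) → (Fin (2 * m') → Γ) → 𝕜 := fun m' => kernel 𝕜 (-V) (2 * m') with hK
  have hXv : vertexOf 𝕜 degs K = X := Subtype.ext (coe_vertexOf_kernel_eq 𝕜 X)
  have hN' : ∀ (m' : ℕ) (j : Fin (2 * m')) (w : Γ), ∑ Y ∈ univ.filter (fun Y : Fin (2 * m') → Γ => Y j = w), ‖K m' Y‖ ≤ N m' := by
    intro m' j w
    have hKnorm : ∀ Y : Fin (2 * m') → Γ, ‖K m' Y‖ = ‖kernel 𝕜 V (2 * m') Y‖ := fun Y => by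
      rw [hK]
      dsimp only
      rw [show -V = (-1 : 𝕜) • V from (neg_one_smul 𝕜 V).symm, kernel_smul, norm_mul, norm_neg, norm_one, one_mul]
    simp only [hKnorm]
    exact hN m' j w
  set κs : ℕ → evenPart 𝕜 Γ := fun n => cumulantOf (fun k => evenGaussConv 𝕜 C (X ^ k)) n with hκs
  have hκs_eq : ∀ n, κs n = cumulantOf (fun k => evenGaussConv 𝕜 C (vertexOf 𝕜 degs K ^ k)) n := fun n => by rw [hXv]
  -- the flat tail at order `N₀`
  obtain ⟨-, hbd⟩ := sum_norm_kernel_effAction_add_sum_cumulant_le_of_gramBounded C hκ hGB V hV hV0 N hN0 hN hα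
    hrow hcol hρ hθ (n₀ := N₀) (by omega)
  have htail := hbd hm i w
  -- the graded bound of one cumulant term, with the `1/n!`
  set G : ℕ → ℝ := fun n => (ρ⁻¹ ^ m * κ⁻¹ ^ (2 * (n - 1)) * (α ^ (n - 1) * Real.exp n)) *
      ∑ δ ∈ (Fintype.piFinset fun _ : Fin n => degs) with m + 2 * (n - 1) ≤ ∑ a, 2 * δ a,
        ∏ a, (Real.exp 2 * (κ + ρ)) ^ (2 * δ a) * N (δ a) with hG
  have hterm : ∀ n, 0 < n → ∑ W ∈ univ.filter (fun W : Fin m → Γ => W i = w),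
      ‖((n ! : 𝕜))⁻¹ * kernel 𝕜 ((κs n : evenPart 𝕜 Γ) : GrassmannAlgebra 𝕜 Γ) m W‖ ≤ G n := by
    intro n hn
    have h := sum_norm_kernel_cumulantOf_le_graded_of_gramBounded C hκ hGB degs K N hN0 hN' hα hrow hcol hρ hn i w
    rw [← hκs_eq] at h
    have hfac : (0 : ℝ) < n ! := by positivity
    calc ∑ W ∈ univ.filter (fun W : Fin m → Γ => W i = w), ‖((n ! : 𝕜))⁻¹ * kernel 𝕜 ((κs n : evenPart 𝕜 Γ) : GrassmannAlgebra 𝕜 Γ) m W‖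
        = (n ! : ℝ)⁻¹ * ∑ W ∈ univ.filter (fun W : Fin m → Γ => W i = w), ‖kernel 𝕜 ((κs n : evenPart 𝕜 Γ) : GrassmannAlgebra 𝕜 Γ) m W‖ := by
          rw [mul_sum]
          exact sum_congr rfl fun W _ => by rw [norm_mul, norm_inv, RCLike.norm_natCast]
      _ ≤ (n ! : ℝ)⁻¹ * ((n ! : ℝ) * (ρ⁻¹ ^ m * κ⁻¹ ^ (2 * (n - 1)) * (α ^ (n - 1) * Real.exp n)) *
            ∑ δ ∈ (Fintype.piFinset fun _ : Fin n => degs) with m + 2 * (n - 1) ≤ ∑ a, 2 * δ a,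
              ∏ a, (Real.exp 2 * (κ + ρ)) ^ (2 * δ a) * N (δ a)) :=
          mul_le_mul_of_nonneg_left h (by positivity)
      _ = G n := by rw [hG]; field_simp
  -- the algebra: `kernel (effAction - e^{Δ}V) = [kernel effAction + Σ_{1 ≤ n < N₀} (n!)⁻¹ kernel κ_n] - Σ_{2 ≤ n < N₀} (n!)⁻¹ kernel κ_n`
  have hone : ∀ W, ((1 ! : 𝕜))⁻¹ * kernel 𝕜 ((κs 1 : evenPart 𝕜 Γ) : GrassmannAlgebra 𝕜 Γ) m W = -kernel 𝕜 (gaussConv 𝕜 C V) m W := by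
    intro W
    rw [hκs]
    dsimp only
    rw [Nat.factorial_one, Nat.cast_one, inv_one, one_mul, cumulantOf_one]
    simp only [pow_one, coe_evenGaussConv, hX, map_neg]
    rw [show -gaussConv 𝕜 C V = (-1 : 𝕜) • gaussConv 𝕜 C V from (neg_one_smul 𝕜 _).symm, kernel_smul]
    ring
  have hsplit : ∀ W, kernel 𝕜 (effAction 𝕜 C V - gaussConv 𝕜 C V) m W =
      (kernel 𝕜 (effAction 𝕜 C V) m W + ∑ n ∈ Ico 1 N₀, ((n ! : 𝕜))⁻¹ * kernel 𝕜 ((κs n : evenPart 𝕜 Γ) : GrassmannAlgebra 𝕜 Γ) m W) -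
        ∑ n ∈ Ico 2 N₀, ((n ! : 𝕜))⁻¹ * kernel 𝕜 ((κs n : evenPart 𝕜 Γ) : GrassmannAlgebra 𝕜 Γ) m W := by
    intro W
    rw [sum_eq_sum_Ico_succ_bot (by omega : 1 < N₀), show ((1 ! : 𝕜))⁻¹ * kernel 𝕜 ((κs 1 : evenPart 𝕜 Γ) : GrassmannAlgebra 𝕜 Γ) m W =
      -kernel 𝕜 (gaussConv 𝕜 C V) m W from hone W,
      show effAction 𝕜 C V - gaussConv 𝕜 C V = effAction 𝕜 C V + (-1 : 𝕜) • gaussConv 𝕜 C V by rw [neg_one_smul, sub_eq_add_neg],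
      kernel_add, kernel_smul]
    ring
  -- assemble
  calc ∑ W ∈ univ.filter (fun W : Fin m → Γ => W i = w), ‖kernel 𝕜 (effAction 𝕜 C V - gaussConv 𝕜 C V) m W‖
      ≤ ∑ W ∈ univ.filter (fun W : Fin m → Γ => W i = w),
          (‖kernel 𝕜 (effAction 𝕜 C V) m W + ∑ n ∈ Ico 1 N₀, ((n ! : 𝕜))⁻¹ * kernel 𝕜 ((κs n : evenPart 𝕜 Γ) : GrassmannAlgebra 𝕜 Γ) m W‖ +
            ∑ n ∈ Ico 2 N₀, ‖((n ! : 𝕜))⁻¹ * kernel 𝕜 ((κs n : evenPart 𝕜 Γ) : GrassmannAlgebra 𝕜 Γ) m W‖) :=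
        sum_le_sum fun W _ => by
          rw [hsplit W]
          exact (norm_sub_le _ _).trans (add_le_add le_rfl (norm_sum_le _ _))
    _ = ∑ W ∈ univ.filter (fun W : Fin m → Γ => W i = w),
          ‖kernel 𝕜 (effAction 𝕜 C V) m W + ∑ n ∈ Ico 1 N₀, ((n ! : 𝕜))⁻¹ * kernel 𝕜 ((κs n : evenPart 𝕜 Γ) : GrassmannAlgebra 𝕜 Γ) m W‖ +
          ∑ n ∈ Ico 2 N₀, ∑ W ∈ univ.filter (fun W : Fin m → Γ => W i = w),
            ‖((n ! : 𝕜))⁻¹ * kernel 𝕜 ((κs n : evenPart 𝕜 Γ) : GrassmannAlgebra 𝕜 Γ) m W‖ := by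
        rw [sum_add_distrib, sum_comm]
    _ ≤ ρ⁻¹ ^ m * (Real.exp 1 * normV Γ κ ρ N) *
          (Real.exp 1 * α * normV Γ κ ρ N / κ ^ 2) ^ (N₀ - 1) / (1 - Real.exp 1 * α * normV Γ κ ρ N / κ ^ 2) +
          ∑ n ∈ Ico 2 N₀, G n :=
        add_le_add htail (sum_le_sum fun n hn => hterm n (by have := (mem_Ico.1 hn).1; omega))
    _ = _ := by rw [hG, add_comm]

end Literature.MathematicalPhysics.QuantumLattice

end
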